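import Literature.Geometry.Hyperkaehler.InvariantTwoFormsTwistorPrimitive
import Mathlib.LinearAlgebra.CrossProduct
import HarnessLib

/-!
# A non-invariant two-form is of type `(1,1)` for at most two (opposite) induced complex
# structures; generic induced complex structures are of general type (Verbitsky 1995)

Pointwise (linear-algebra), degree-`2` content of Verbitsky's genericity proposition for the induced
complex structures `L = aI + bJ + cK`, `(a, b, c) ∈ S²`, of a hyperkähler manifold (Verbitsky 1995,
GAFA 5 = arXiv alg-geom/9403006 "Hyperkähler embeddings and holomorphic symplectic geometry II", §2):

> "Let `M` be a hyperkähler manifold. Let `S` be the set of induced complex structures over `M`. Let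
> `S₀ ⊂ S` be the set of `R ∈ S` such that the natural Kähler metric on `(M, R)` induces the
> `SU(2)` action of general type [all elements of `H^{pp}(M) ∩ H^{2p}(M, ℤ)` are `G_M`-invariant].
> Then `S₀` is dense in `S`.
> Proof: Let `A` be the set of all `α ∈ H^{2p}(M, ℤ)` such that `α` is not `G_M`-invariant. The set
> `A` is countable. For each `α ∈ A`, let `S_α` be the set of all `R ∈ S` such that `α` is of type
> `(p,p)` with respect to `R`. … it is sufficient to show that `S_α` is a finite set for each `α ∈ A`.
> This would imply that `S₀` is a complement of a countable set to a 2-sphere `S`, and therefore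
> dense in `S`. As it follows from Section 1, `α` is of type `(p,p)` with respect to `R` if and only
> if `ad R(α) = 0`. Now, let `V` be a representation of `𝔰𝔲(2)`, and `v ∈ V` be a non-invariant
> vector. It is easy to see that the element `a ∈ 𝔰𝔲(2)` such that `a(v) = 0` is unique up to a
> constant, if it exists. This implies that if `α` is not `G_M`-invariant there are no more than two
> `R ∈ S` such that `ad R(α) = 0`. Of course, these two elements of `S` are opposite to each other."

On the tree's carrier `IsLinearHyperkaehler g₀ J` (complex normed space `E`, `I = i•`, `K = IJ`, twistor
operators `λ_x = x₀ I + x₁ J + x₂ K` for `x : Fin 3 → ℝ`), for `2`-covectors `β : E [⋀^Fin 2]→L[ℝ] W`;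
"type `(1,1)` with respect to `R`" for a `2`-form is "`R`-invariant", and "`G_M`-invariant" is
"`β(I·, I·) = β = β(J·, J·)`" (then `β` is invariant under every unit twistor operator,
`IsLinearHyperkaehler.apply₂_twistorOp`, `InvariantTwoFormsTwistorPrimitive.lean`):

* §1 `apply₂_skew_of_invariant` / `apply₂_invariant_of_skew`: for `T² = −1`, `T`-invariance of `β` is
  `ad T`-invariance `β(T·, ·) + β(·, T·) = 0` ("type `(p,p)` for `R` iff `ad R(α) = 0`", degree `2`).
* §2 `twistorOp_commutator`: `[λ_x, λ_y] = 2 λ_{x × y}` (the quaternion relations; `𝔤_M ≅ 𝔰𝔲(2)`).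
* §3 **`apply₂_I_J_invariant_of_two_twistorOp`**: invariance under two unit twistor operators `λ_x, λ_y`
  with `x × y ≠ 0` forces `SU(2)`-invariance (the `β`-skew operators form a Lie subalgebra containing
  `λ_x, λ_y, λ_{x×y}`, and `x, y, x × y` span `ℝ³`) — "the element `a ∈ 𝔰𝔲(2)` with `a(v) = 0` is
  unique up to a constant".
* §4 **`eq_or_eq_neg_of_apply₂_twistorOp_invariant`**: a NON-invariant `β` is invariant under at most two,
  antipodal, unit twistor operators ("no more than two `R ∈ S` … opposite to each other");
  `finite_setOf_apply₂_twistorOp_invariant` ("`S_α` is a finite set").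
* §5 **`countable_setOf_exists_apply₂_twistorOp_invariant`**: for a COUNTABLE family `A` of `2`-covectors
  the set of unit parameters making some non-invariant member of `A` invariant is countable ("`S₀` is a
  complement of a countable set").
* §6 **`exists_near_forall_apply₂_twistorOp_invariant_imp`**: its complement is dense — every unit `x` is
  within any `ε` of a unit `x'` for which every `λ_{x'}`-invariant member of `A` is `SU(2)`-invariant
  (the great circle through `x` is injective on `[−π/2, π/2]` and a countable subset of `ℝ` has dense
  complement, `Set.Countable.dense_compl`).

Torus-level reading (the case the lane uses): for a hyperkähler complex torus `E/Λ` and `A` = the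
rational constant two-forms, every induced complex structure outside a countable subset of `S²` has all
its rational constant `(1,1)`-forms `SU(2)`-invariant — hence `ω_λ`-primitive for every `λ` and
Hodge–Riemann-negative (`InvariantTwoFormsTwistorPrimitive.lean`). Scope: degree `2` only (Verbitsky's
proposition is stated for all degrees `2p` with the `𝔰𝔲(2)` Lie-algebra action; the tree has no
`ad`-action on higher-degree forms of the carrier).

## References

* [Verbitsky1995Trianalytic] M. Verbitsky, *Tri-analytic subvarieties of hyperkaehler manifolds*, GAFA 5
  (1995) 92–104 (arXiv alg-geom/9403006, "Hyperkähler embeddings and holomorphic symplectic geometry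
  II"), §2, the Proposition "`S₀` is dense in `S`" and its proof (arXiv text, chunk 3, L84–L110).
* [Verbitsky1996Hyperholomorphic] M. Verbitsky, *Hyperholomorphic bundles over a hyperkähler manifold*,
  J. Alg. Geom. 5 (1996), §1 Prop. 1.2 (`G_M`-invariant ⟺ type `(p,p)` for all induced `L`).
-/

noncomputable section

open Module Function Complex Finset
open scoped Matrix

namespace Literature.Geometry.Hyperkaehler

variable {E : Type*} [NormedAddCommGroup E] [NormedSpace ℂ E]
  {g₀ : E →L[ℝ] E →L[ℝ] ℝ} {J : E →L[ℝ] E}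
  {W : Type*} [NormedAddCommGroup W] [NormedSpace ℝ W]

/-! ## §1 Invariance under an operator of square `−1` versus `ad`-invariance -/

/-- **`R`-invariance is `ad R`-invariance** for an operator with `R² = −1` (Verbitsky: "`α` is of type
`(p,p)` with respect to `R` if and only if `ad R(α) = 0`", degree `2`): if `β(T·, T·) = β` then
`β(T·, ·) + β(·, T·) = 0`. [cite: Verbitsky1995Trianalytic, §2 (proof of the Proposition "S₀ is dense in S")] -/
theorem apply₂_skew_of_invariant {T : E → E} (hT : ∀ v, T (T v) = -v) {β : E [⋀^Fin 2]→L[ℝ] W}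
    (hinv : ∀ v w : E, β ![T v, T w] = β ![v, w]) (v w : E) : β ![T v, w] = -β ![v, T w] := by
  have e := hinv (T v) w
  rw [hT, apply₂_neg_left] at e
  exact e.symm

/-- Conversely, `β(T·, ·) + β(·, T·) = 0` and `T² = −1` give `β(T·, T·) = β`.
[cite: Verbitsky1995Trianalytic, §2 (proof of the Proposition "S₀ is dense in S")] -/
theorem apply₂_invariant_of_skew {T : E → E} (hT : ∀ v, T (T v) = -v) {β : E [⋀^Fin 2]→L[ℝ] W}
    (hskew : ∀ v w : E, β ![T v, w] = -β ![v, T w]) (v w : E) : β ![T v, T w] = β ![v, w] := by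
  rw [hskew, hT, apply₂_neg_right, neg_neg]

/-- The `β`-skew operators are closed under commutators (`ad` is a Lie algebra action). [folklore] -/
private theorem skew_commutator {β : E [⋀^Fin 2]→L[ℝ] W} {A B : E → E}
    (hA : ∀ v w : E, β ![A v, w] = -β ![v, A w]) (hB : ∀ v w : E, β ![B v, w] = -β ![v, B w])
    (v w : E) : β ![A (B v) - B (A v), w] = -β ![v, A (B w) - B (A w)] := by
  rw [sub_eq_add_neg, sub_eq_add_neg]
  simp only [apply₂_add_left, apply₂_neg_left, apply₂_add_right, apply₂_neg_right, hA, hB]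
  abel

/-! ## §2 Twistor operators: commutators are cross products -/

namespace IsLinearHyperkaehler

/-- **`[λ_x, λ_y] = 2 λ_{x × y}`** for twistor operators `λ_x = x₀ I + x₁ J + x₂ K` (the quaternion
relations `IJ = K = −JI` etc.: `Im ℍ ≅ (ℝ³, ×)` as Lie algebras up to the factor `2`).
[cite: Verbitsky1995Trianalytic, §2 ("𝔤_M ≅ 𝔰𝔲(2)")] -/
theorem twistorOp_commutator (h : IsLinearHyperkaehler g₀ J) (x y : Fin 3 → ℝ) (v : E) :
    (x 0 • opI E + x 1 • J + x 2 • opK J) ((y 0 • opI E + y 1 • J + y 2 • opK J) v) -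
        (y 0 • opI E + y 1 • J + y 2 • opK J) ((x 0 • opI E + x 1 • J + x 2 • opK J) v) =
      (2 : ℝ) • ((x 1 * y 2 - x 2 * y 1) • I • v + (x 2 * y 0 - x 0 * y 2) • J v +
        (x 0 * y 1 - x 1 * y 0) • I • J v) := by
  simp only [add_apply, smul_apply, opI_apply, opK_apply, map_add, map_smul, smul_add, smul_smul,
    I_mul_I, h.J_J, h.J_I, smul_neg, neg_one_smul, neg_neg]
  module

/-- The twistor operator of the cross product `x × y`, unfolded. [folklore] -/
private theorem twistorOp_cross_apply (x y : Fin 3 → ℝ) (v : E) :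
    ((x ⨯₃ y) 0 • opI E + (x ⨯₃ y) 1 • J + (x ⨯₃ y) 2 • opK J) v =
      (x 1 * y 2 - x 2 * y 1) • I • v + (x 2 * y 0 - x 0 * y 2) • J v +
        (x 0 * y 1 - x 1 * y 0) • I • J v := by
  simp only [cross_apply, Matrix.cons_val_zero, Matrix.cons_val_one, Matrix.cons_val_two, Matrix.head_cons,
    Matrix.tail_cons, add_apply, smul_apply, opI_apply, opK_apply]

/-- The twistor operator is linear in its parameter: `λ_{c•z} v = c • λ_z v`. [folklore] -/
private theorem twistorOp_smul_param (c : ℝ) (z : Fin 3 → ℝ) (v : E) :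
    ((c • z) 0 • opI E + (c • z) 1 • J + (c • z) 2 • opK J) v =
      c • (z 0 • opI E + z 1 • J + z 2 • opK J) v := by
  simp only [Pi.smul_apply, smul_eq_mul, add_apply, smul_apply, smul_add, smul_smul]

/-- The twistor operator is linear in its parameter: three-term combinations. [folklore] -/
private theorem twistorOp_lincomb_param (a b c : ℝ) (x y n : Fin 3 → ℝ) (v : E) :
    ((a • x + b • y + c • n) 0 • opI E + (a • x + b • y + c • n) 1 • J + (a • x + b • y + c • n) 2 • opK J) v
      = a • (x 0 • opI E + x 1 • J + x 2 • opK J) v + b • (y 0 • opI E + y 1 • J + y 2 • opK J) v +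
        c • (n 0 • opI E + n 1 • J + n 2 • opK J) v := by
  simp only [Pi.add_apply, Pi.smul_apply, smul_eq_mul, add_apply, smul_apply, smul_add, smul_smul, add_smul]
  abel

/-- Coordinates with respect to the basis `x, y, x × y` of `ℝ³` (valid when `x × y ≠ 0`):
`|n|² z = ⟨z, y × n⟩ x + ⟨z, n × x⟩ y + ⟨z, n⟩ n` for `n = x × y`. [folklore] -/
private theorem cross_coordinates (x y z : Fin 3 → ℝ) :
    ((x ⨯₃ y) ⬝ᵥ (x ⨯₃ y)) • z =
      (z ⬝ᵥ (y ⨯₃ (x ⨯₃ y))) • x + (z ⬝ᵥ ((x ⨯₃ y) ⨯₃ x)) • y + (z ⬝ᵥ (x ⨯₃ y)) • (x ⨯₃ y) := by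
  obtain ⟨a₀, a₁, a₂, rfl⟩ : ∃ a₀ a₁ a₂ : ℝ, x = ![a₀, a₁, a₂] :=
    ⟨x 0, x 1, x 2, by ext i; fin_cases i <;> rfl⟩
  obtain ⟨b₀, b₁, b₂, rfl⟩ : ∃ b₀ b₁ b₂ : ℝ, y = ![b₀, b₁, b₂] :=
    ⟨y 0, y 1, y 2, by ext i; fin_cases i <;> rfl⟩
  obtain ⟨c₀, c₁, c₂, rfl⟩ : ∃ c₀ c₁ c₂ : ℝ, z = ![c₀, c₁, c₂] :=
    ⟨z 0, z 1, z 2, by ext i; fin_cases i <;> rfl⟩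
  simp only [cross_apply, Matrix.cons_val_zero, Matrix.cons_val_one, Matrix.cons_val_two, Matrix.head_cons,
    Matrix.tail_cons, Matrix.vec3_dotProduct', Matrix.smul_vec3, Matrix.vec3_add, smul_eq_mul]
  refine Matrix.vec3_eq ?_ ?_ ?_ <;> ring

/-- Unit vectors with vanishing cross product are equal or opposite. [folklore] -/
private theorem eq_or_eq_neg_of_cross_eq_zero {x y : Fin 3 → ℝ} (hx : x ⬝ᵥ x = 1) (hy : y ⬝ᵥ y = 1)
    (h0 : x ⨯₃ y = 0) : x = y ∨ x = -y := by
  have h1 : x ⬝ᵥ y * (x ⬝ᵥ y) = 1 := by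
    have e := cross_dot_cross x y x y
    rw [h0, dotProduct_zero, hx, hy, dotProduct_comm y x] at e
    linarith
  rcases mul_self_eq_one_iff.1 h1 with h | h
  · left
    have e : (x - y) ⬝ᵥ (x - y) = 0 := by
      rw [sub_dotProduct, dotProduct_sub, dotProduct_sub, hx, hy, dotProduct_comm y x, h]; ring
    exact sub_eq_zero.1 (dotProduct_self_eq_zero.1 e)
  · right
    have e : (x + y) ⬝ᵥ (x + y) = 0 := by
      rw [add_dotProduct, dotProduct_add, dotProduct_add, hx, hy, dotProduct_comm y x, h]; ring
    exact eq_neg_of_add_eq_zero_left (dotProduct_self_eq_zero.1 e)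

/-! ## §3 Two non-proportional induced complex structures of type `(1,1)` force `SU(2)`-invariance -/

/-- **Two induced complex structures of type `(1,1)` force `SU(2)`-invariance** (Verbitsky: "the element
`a ∈ 𝔰𝔲(2)` such that `a(v) = 0` is unique up to a constant, if it exists", for a non-invariant `v`),
degree `2`, pointwise on a quaternionic Hermitian vector space: if a `2`-covector `β` is invariant under
two UNIT twistor operators `λ_x`, `λ_y` with `x × y ≠ 0`, then `β(I·, I·) = β = β(J·, J·)` (so `β` is
invariant under every twistor operator, `IsLinearHyperkaehler.apply₂_twistorOp`). Proof: the `β`-skew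
operators form a Lie subalgebra containing `λ_x`, `λ_y`, hence `[λ_x, λ_y] = 2λ_{x×y}`, hence every
`λ_z` (`x, y, x × y` span `ℝ³`). [cite: Verbitsky1995Trianalytic, §2 (Proposition "S₀ is dense in S", proof)] -/
theorem apply₂_I_J_invariant_of_two_twistorOp (h : IsLinearHyperkaehler g₀ J) {β : E [⋀^Fin 2]→L[ℝ] W}
    {x y : Fin 3 → ℝ} (hx : x 0 ^ 2 + x 1 ^ 2 + x 2 ^ 2 = 1) (hy : y 0 ^ 2 + y 1 ^ 2 + y 2 ^ 2 = 1)
    (hxy : x ⨯₃ y ≠ 0)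
    (hβx : ∀ v w : E, β ![(x 0 • opI E + x 1 • J + x 2 • opK J) v, (x 0 • opI E + x 1 • J + x 2 • opK J) w]
      = β ![v, w])
    (hβy : ∀ v w : E, β ![(y 0 • opI E + y 1 • J + y 2 • opK J) v, (y 0 • opI E + y 1 • J + y 2 • opK J) w]
      = β ![v, w]) :
    (∀ v w : E, β ![I • v, I • w] = β ![v, w]) ∧ (∀ v w : E, β ![J v, J w] = β ![v, w]) := by
  -- skewness for `λ_x`, `λ_y`
  have sx := apply₂_skew_of_invariant (h.twistor_sq_eq_neg hx) hβx
  have sy := apply₂_skew_of_invariant (h.twistor_sq_eq_neg hy) hβy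
  -- skewness for `λ_n`, `n = x × y` (commutator)
  set n := x ⨯₃ y with hn
  have sn : ∀ v w : E, β ![(n 0 • opI E + n 1 • J + n 2 • opK J) v, w] =
      -β ![v, (n 0 • opI E + n 1 • J + n 2 • opK J) w] := by
    intro v w
    have e := skew_commutator sx sy v w
    rw [h.twistorOp_commutator x y v, h.twistorOp_commutator x y w, ← twistorOp_cross_apply,
      ← twistorOp_cross_apply, apply₂_smul_left, apply₂_smul_right, ← smul_neg] at e
    exact (smul_right_inj two_ne_zero).1 e
  -- skewness for every `λ_z`
  have hnn : n ⬝ᵥ n ≠ 0 := fun h0 ↦ hxy (dotProduct_self_eq_zero.1 h0)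
  have sz : ∀ (z : Fin 3 → ℝ) (v w : E), β ![(z 0 • opI E + z 1 • J + z 2 • opK J) v, w] =
      -β ![v, (z 0 • opI E + z 1 • J + z 2 • opK J) w] := by
    intro z v w
    have key : β ![(((n ⬝ᵥ n) • z) 0 • opI E + ((n ⬝ᵥ n) • z) 1 • J + ((n ⬝ᵥ n) • z) 2 • opK J) v, w] =
        -β ![v, (((n ⬝ᵥ n) • z) 0 • opI E + ((n ⬝ᵥ n) • z) 1 • J + ((n ⬝ᵥ n) • z) 2 • opK J) w] := by
      rw [hn, cross_coordinates x y z, ← hn, twistorOp_lincomb_param, twistorOp_lincomb_param]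
      simp only [apply₂_add_left, apply₂_smul_left, apply₂_add_right, apply₂_smul_right, sx, sy, sn, smul_neg,
        neg_add]
    rw [twistorOp_smul_param, twistorOp_smul_param, apply₂_smul_left, apply₂_smul_right, ← smul_neg] at key
    exact (smul_right_inj hnn).1 key
  refine ⟨fun v w ↦ ?_, fun v w ↦ ?_⟩
  · have s : ∀ v w : E, β ![I • v, w] = -β ![v, I • w] := fun v w ↦ by
      simpa [Matrix.cons_val_zero, Matrix.cons_val_one, Matrix.cons_val_two, Matrix.head_cons, Matrix.tail_cons,
        add_apply, smul_apply, opI_apply, opK_apply] using sz ![1, 0, 0] v w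
    exact apply₂_invariant_of_skew (T := fun v : E ↦ I • v)
      (fun v ↦ by rw [smul_smul, I_mul_I, neg_one_smul]) s v w
  · have s : ∀ v w : E, β ![J v, w] = -β ![v, J w] := fun v w ↦ by
      simpa [Matrix.cons_val_zero, Matrix.cons_val_one, Matrix.cons_val_two, Matrix.head_cons, Matrix.tail_cons,
        add_apply, smul_apply, opI_apply, opK_apply] using sz ![0, 1, 0] v w
    exact apply₂_invariant_of_skew (T := fun v : E ↦ J v) h.J_J s v w

/-! ## §4 At most two (opposite) induced complex structures make a non-invariant two-form `(1,1)` -/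

/-- **A non-invariant two-form is of type `(1,1)` for at most two, opposite, induced complex structures**
(Verbitsky: "if `α` is not `G_M`-invariant there are no more than two `R ∈ S` such that `ad R(α) = 0`.
Of course, these two elements of `S` are opposite to each other"), degree `2`, pointwise: if `β` is NOT
`SU(2)`-invariant and is invariant under the unit twistor operators `λ_x` and `λ_y`, then `x = y` or
`x = −y`. [cite: Verbitsky1995Trianalytic, §2 (Proposition "S₀ is dense in S", proof)] -/
theorem eq_or_eq_neg_of_apply₂_twistorOp_invariant (h : IsLinearHyperkaehler g₀ J) {β : E [⋀^Fin 2]→L[ℝ] W}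
    (hβ : ¬ ((∀ v w : E, β ![I • v, I • w] = β ![v, w]) ∧ ∀ v w : E, β ![J v, J w] = β ![v, w]))
    {x y : Fin 3 → ℝ} (hx : x 0 ^ 2 + x 1 ^ 2 + x 2 ^ 2 = 1) (hy : y 0 ^ 2 + y 1 ^ 2 + y 2 ^ 2 = 1)
    (hβx : ∀ v w : E, β ![(x 0 • opI E + x 1 • J + x 2 • opK J) v, (x 0 • opI E + x 1 • J + x 2 • opK J) w]
      = β ![v, w])
    (hβy : ∀ v w : E, β ![(y 0 • opI E + y 1 • J + y 2 • opK J) v, (y 0 • opI E + y 1 • J + y 2 • opK J) w]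
      = β ![v, w]) :
    x = y ∨ x = -y := by
  by_contra hne
  obtain ⟨h1, h2⟩ := not_or.1 hne
  have hx' : x ⬝ᵥ x = 1 := by rw [Matrix.vec3_dotProduct, ← hx]; ring
  have hy' : y ⬝ᵥ y = 1 := by rw [Matrix.vec3_dotProduct, ← hy]; ring
  have hxy : x ⨯₃ y ≠ 0 := fun h0 ↦ (eq_or_eq_neg_of_cross_eq_zero hx' hy' h0).elim h1 h2
  exact hβ (h.apply₂_I_J_invariant_of_two_twistorOp hx hy hxy hβx hβy)

/-- The set `S_β ⊂ S²` of unit parameters whose twistor operator leaves a NON-invariant `β` invariant is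
finite (it has at most two, antipodal, points).
[cite: Verbitsky1995Trianalytic, §2 (Proposition "S₀ is dense in S", proof: "S_α is a finite set")] -/
theorem finite_setOf_apply₂_twistorOp_invariant (h : IsLinearHyperkaehler g₀ J) {β : E [⋀^Fin 2]→L[ℝ] W}
    (hβ : ¬ ((∀ v w : E, β ![I • v, I • w] = β ![v, w]) ∧ ∀ v w : E, β ![J v, J w] = β ![v, w])) :
    {x : Fin 3 → ℝ | x 0 ^ 2 + x 1 ^ 2 + x 2 ^ 2 = 1 ∧
      ∀ v w : E, β ![(x 0 • opI E + x 1 • J + x 2 • opK J) v, (x 0 • opI E + x 1 • J + x 2 • opK J) w]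
        = β ![v, w]}.Finite := by
  by_cases hS : {x : Fin 3 → ℝ | x 0 ^ 2 + x 1 ^ 2 + x 2 ^ 2 = 1 ∧
      ∀ v w : E, β ![(x 0 • opI E + x 1 • J + x 2 • opK J) v, (x 0 • opI E + x 1 • J + x 2 • opK J) w]
        = β ![v, w]}.Nonempty
  · obtain ⟨x₀, hx₀, hβx₀⟩ := hS
    refine ((Set.finite_singleton (-x₀)).insert x₀).subset fun x hx ↦ ?_
    rcases h.eq_or_eq_neg_of_apply₂_twistorOp_invariant hβ hx.1 hx₀ hx.2 hβx₀ with e | e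
    · exact Or.inl e
    · exact Or.inr e
  · rw [Set.not_nonempty_iff_eq_empty.1 hS]
    exact Set.finite_empty

/-! ## §5 Genericity: outside a countable subset of `S²` every invariant member of a countable family is
`SU(2)`-invariant -/

/-- **Generic induced complex structures are of general type** (Verbitsky's Proposition: "Let `S₀ ⊂ S` be
the set of `R ∈ S` such that … all elements of `H^{pp}(M) ∩ H^{2p}(M, ℤ)` are `G_M`-invariant. Then `S₀`
is dense in `S`", proof: "`S₀` is a complement of a countable set"), degree `2`, pointwise, for an
arbitrary COUNTABLE family `A` of `2`-covectors (e.g. the rational constant two-forms of a hyperkähler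
complex torus): the set of unit parameters `x ∈ S²` for which SOME member of `A` that is not
`SU(2)`-invariant is `λ_x`-invariant is countable. (For `x` outside it, every `λ_x`-invariant member of `A`
is `SU(2)`-invariant, hence `ω_λ`-primitive for all `λ` and Hodge–Riemann-negative,
`InvariantTwoFormsTwistorPrimitive.lean`.) The density of the complement in `S²` is not recorded.
[cite: Verbitsky1995Trianalytic, §2 (Proposition "S₀ is dense in S")] -/
theorem countable_setOf_exists_apply₂_twistorOp_invariant (h : IsLinearHyperkaehler g₀ J)
    {A : Set (E [⋀^Fin 2]→L[ℝ] W)} (hA : A.Countable) :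
    {x : Fin 3 → ℝ | x 0 ^ 2 + x 1 ^ 2 + x 2 ^ 2 = 1 ∧ ∃ β ∈ A,
      ¬ ((∀ v w : E, β ![I • v, I • w] = β ![v, w]) ∧ ∀ v w : E, β ![J v, J w] = β ![v, w]) ∧
      ∀ v w : E, β ![(x 0 • opI E + x 1 • J + x 2 • opK J) v, (x 0 • opI E + x 1 • J + x 2 • opK J) w]
        = β ![v, w]}.Countable := by
  have hsub : {x : Fin 3 → ℝ | x 0 ^ 2 + x 1 ^ 2 + x 2 ^ 2 = 1 ∧ ∃ β ∈ A,
      ¬ ((∀ v w : E, β ![I • v, I • w] = β ![v, w]) ∧ ∀ v w : E, β ![J v, J w] = β ![v, w]) ∧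
      ∀ v w : E, β ![(x 0 • opI E + x 1 • J + x 2 • opK J) v, (x 0 • opI E + x 1 • J + x 2 • opK J) w]
        = β ![v, w]} ⊆
      ⋃ β ∈ A, {x : Fin 3 → ℝ |
        ¬ ((∀ v w : E, β ![I • v, I • w] = β ![v, w]) ∧ ∀ v w : E, β ![J v, J w] = β ![v, w]) ∧
        (x 0 ^ 2 + x 1 ^ 2 + x 2 ^ 2 = 1 ∧
        ∀ v w : E, β ![(x 0 • opI E + x 1 • J + x 2 • opK J) v, (x 0 • opI E + x 1 • J + x 2 • opK J) w]
          = β ![v, w])} := by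
    rintro x ⟨hx, β, hβA, hβ, hβx⟩
    exact Set.mem_biUnion hβA ⟨hβ, hx, hβx⟩
  refine (Set.Countable.biUnion hA fun β _ ↦ ?_).mono hsub
  by_cases hβ : (∀ v w : E, β ![I • v, I • w] = β ![v, w]) ∧ ∀ v w : E, β ![J v, J w] = β ![v, w]
  · exact Set.countable_empty.mono fun x hx ↦ (hx.1 hβ).elim
  · exact ((h.finite_setOf_apply₂_twistorOp_invariant hβ).subset fun x hx ↦ hx.2).countable

/-! ## §6 Density: every unit parameter is a limit of generic ones -/

/-- A unit vector of `ℝ³` orthogonal to a given vector. [folklore] -/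
private theorem exists_unit_orthogonal' (a b c : ℝ) :
    ∃ p q r : ℝ, p ^ 2 + q ^ 2 + r ^ 2 = 1 ∧ a * p + b * q + c * r = 0 := by
  by_cases hbc : b ^ 2 + c ^ 2 = 0
  · have hb : b = 0 := (pow_eq_zero_iff two_ne_zero).1 (by nlinarith [sq_nonneg b, sq_nonneg c])
    have hc : c = 0 := (pow_eq_zero_iff two_ne_zero).1 (by nlinarith [sq_nonneg b, sq_nonneg c])
    exact ⟨0, 1, 0, by norm_num, by rw [hb, hc]; ring⟩
  · have hpos : 0 < b ^ 2 + c ^ 2 := lt_of_le_of_ne (by positivity) (Ne.symm hbc)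
    set t := Real.sqrt (b ^ 2 + c ^ 2) with ht
    have ht2 : t ^ 2 = b ^ 2 + c ^ 2 := Real.sq_sqrt hpos.le
    have ht0 : t ≠ 0 := (Real.sqrt_pos.2 hpos).ne'
    have H1 : t⁻¹ ^ 2 * (b ^ 2 + c ^ 2) = 1 := by
      rw [← ht2, inv_pow, inv_mul_cancel₀ (pow_ne_zero 2 ht0)]
    refine ⟨0, c / t, -b / t, ?_, ?_⟩
    · linear_combination H1
    · ring

/-- **Generic induced complex structures are dense** (Verbitsky: "`S₀` is a complement of a countable set
to a 2-sphere `S`, and therefore dense in `S`"), degree `2`, pointwise, for a countable family `A` of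
`2`-covectors: every unit parameter `x` is within any `ε > 0` of a unit parameter `x'` such that every
`λ_{x'}`-invariant member of `A` is `SU(2)`-invariant (the great circle through `x` meets the countable
exceptional set of §5 in countably many parameters, whose complement is dense in `ℝ`).
[cite: Verbitsky1995Trianalytic, §2 (Proposition "S₀ is dense in S")] -/
theorem exists_near_forall_apply₂_twistorOp_invariant_imp (h : IsLinearHyperkaehler g₀ J)
    {A : Set (E [⋀^Fin 2]→L[ℝ] W)} (hA : A.Countable) {x : Fin 3 → ℝ}
    (hx : x 0 ^ 2 + x 1 ^ 2 + x 2 ^ 2 = 1) {ε : ℝ} (hε : 0 < ε) :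
    ∃ x' : Fin 3 → ℝ, x' 0 ^ 2 + x' 1 ^ 2 + x' 2 ^ 2 = 1 ∧ dist x' x < ε ∧
      ∀ β ∈ A, (∀ v w : E, β ![(x' 0 • opI E + x' 1 • J + x' 2 • opK J) v,
          (x' 0 • opI E + x' 1 • J + x' 2 • opK J) w] = β ![v, w]) →
        (∀ v w : E, β ![I • v, I • w] = β ![v, w]) ∧ ∀ v w : E, β ![J v, J w] = β ![v, w] := by
  -- the exceptional set of §5
  set B := {x : Fin 3 → ℝ | x 0 ^ 2 + x 1 ^ 2 + x 2 ^ 2 = 1 ∧ ∃ β ∈ A,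
      ¬ ((∀ v w : E, β ![I • v, I • w] = β ![v, w]) ∧ ∀ v w : E, β ![J v, J w] = β ![v, w]) ∧
      ∀ v w : E, β ![(x 0 • opI E + x 1 • J + x 2 • opK J) v, (x 0 • opI E + x 1 • J + x 2 • opK J) w]
        = β ![v, w]} with hB_def
  have hB : B.Countable := h.countable_setOf_exists_apply₂_twistorOp_invariant hA
  -- the great circle `θ ↦ cos θ · x + sin θ · u` through `x`, `u ⟂ x` a unit vector
  obtain ⟨p, q, r, hu, horth⟩ := exists_unit_orthogonal' (x 0) (x 1) (x 2)
  set u : Fin 3 → ℝ := ![p, q, r] with hu_def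
  set γ : ℝ → (Fin 3 → ℝ) := fun θ ↦ Real.cos θ • x + Real.sin θ • u with hγ_def
  have hγ1 : ∀ θ, (γ θ) 0 ^ 2 + (γ θ) 1 ^ 2 + (γ θ) 2 ^ 2 = 1 := fun θ ↦ by
    simp only [hγ_def, hu_def, Pi.add_apply, Pi.smul_apply, smul_eq_mul, Matrix.cons_val_zero,
      Matrix.cons_val_one, Matrix.cons_val_two, Matrix.head_cons, Matrix.tail_cons]
    linear_combination (Real.cos θ) ^ 2 * hx + (Real.sin θ) ^ 2 * hu +
      2 * Real.cos θ * Real.sin θ * horth + Real.cos_sq_add_sin_sq θ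
  -- it is injective on `[-π/2, π/2]` (`sin θ = ⟨u, γ θ⟩`)
  have hinj : Set.InjOn γ (Set.Icc (-(Real.pi / 2)) (Real.pi / 2)) := by
    intro θ₁ h₁ θ₂ h₂ heq
    have e := congrArg (fun w : Fin 3 → ℝ ↦ p * w 0 + q * w 1 + r * w 2) heq
    simp only [hγ_def, hu_def, Pi.add_apply, Pi.smul_apply, smul_eq_mul, Matrix.cons_val_zero,
      Matrix.cons_val_one, Matrix.cons_val_two, Matrix.head_cons, Matrix.tail_cons] at e
    have hs : Real.sin θ₁ = Real.sin θ₂ := by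
      linear_combination e - (Real.sin θ₁ - Real.sin θ₂) * hu - (Real.cos θ₁ - Real.cos θ₂) * horth
    exact Real.injOn_sin h₁ h₂ hs
  -- so only countably many parameters in `[-π/2, π/2]` hit `B`, and the rest is dense in `ℝ`
  have hT : (Set.Icc (-(Real.pi / 2)) (Real.pi / 2) ∩ γ ⁻¹' B).Countable :=
    Set.MapsTo.countable_of_injOn (f := γ) (t := B) (fun θ hθ ↦ hθ.2) (hinj.mono Set.inter_subset_left) hB
  have hdense : Dense (Set.Icc (-(Real.pi / 2)) (Real.pi / 2) ∩ γ ⁻¹' B)ᶜ := hT.dense_compl ℝ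
  -- continuity of the circle at `θ = 0`, where it passes through `x`
  have hcont : Continuous γ :=
    (Real.continuous_cos.smul continuous_const).add (Real.continuous_sin.smul continuous_const)
  have hγ0 : γ 0 = x := by simp [hγ_def]
  obtain ⟨δ, hδ, hδε⟩ := Metric.continuous_iff.1 hcont 0 ε hε
  have hm : 0 < min δ 1 := lt_min hδ one_pos
  obtain ⟨θ, hθU, hθT⟩ := hdense.inter_open_nonempty (Set.Ioo (-min δ 1) (min δ 1)) isOpen_Ioo
    ⟨0, by rw [Set.mem_Ioo]; exact ⟨by linarith, hm⟩⟩
  have hθabs : |θ| < min δ 1 := abs_lt.2 ⟨hθU.1, hθU.2⟩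
  refine ⟨γ θ, hγ1 θ, ?_, fun β hβA hinv ↦ ?_⟩
  · rw [← hγ0]
    exact hδε θ (by rw [Real.dist_eq, sub_zero]; exact hθabs.trans_le (min_le_left _ _))
  · by_contra hSU
    apply hθT
    have hπ : (1 : ℝ) ≤ Real.pi / 2 := by linarith [Real.pi_gt_three]
    have h1 : |θ| < 1 := hθabs.trans_le (min_le_right _ _)
    refine ⟨⟨by linarith [(abs_lt.1 h1).1], by linarith [(abs_lt.1 h1).2]⟩, ?_⟩
    exact ⟨hγ1 θ, β, hβA, hSU, hinv⟩

end IsLinearHyperkaehler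

end Literature.Geometry.Hyperkaehler

end
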